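import Summits.BirchSwinnertonDyer.BirchSwinnertonDyer.Theses.ErratumRoadFive
import Summits.BirchSwinnertonDyer.BirchSwinnertonDyer.Theorems.ErratumRoadFiveIMCDivRoadFFSigmaDataBNoDefect
import Summits.BirchSwinnertonDyer.BirchSwinnertonDyer.Theorems.ErratumRoadFiveIMCDivRoadFFFittingFrameBOfMembers
import HarnessLib

/-!
# Route `ErratumRoadFive` (rung K2, `p ≥ 5`), crux `IMCDivAtErratumDataAllR` (item stmt-BirchSwinnertonDyer-20169)
# BY THE ROUTE'S NAME, MODULO NAMED FACTS — the Road-FF certificate with the OPEN input in TORSION-FREE PREMISE form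

Cell `bsd-stepL` (run/shared/lean/pub/bsd-stepL/), seat `bsd-stepL-imc-p1` (prover g11, 2026-08-27);
`--supports stmt-BirchSwinnertonDyer-20169 --as helper`. Twin of imc-p1 g10's
`Theorems/ErratumRoadFiveIMCDivAtErratumDataAllROfFacts.lean` (p520089 ∕ p520999) with the ONE OPEN named fact
RE-TARGETED (design rider R-f = ARM-P R-37, bsd-cited-r17 D-AUDIT ADDENDUM-7; director ROUTING 2026-08-27T07:51:22Z)
from O14 `Castella2018.erratum_members_exists_isTorsion_charIdeal_le_congruence_OPEN` to its torsion-free premise form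
`Castella2018.erratum_members_exists_charIdeal_le_of_isTorsion_congruence_OPEN` (O14 ⟹ it): the members' torsion clause
of erratum Thm. 2.3 (Heegner side at weight `k_m ≥ p + 1`, ARM-P GAP-β provenance) is not used by the Road FF and leaves
the crux's OPEN input. This file imports the route file (to name the crux decl), imc-p1 g9's `Σ`-data
`P2.RoadFF.sigmaDataAtErratumDataB_of_prop332_of_noTamagawaDefect` (p500562) and this seat's deciding stub
`P2.RoadFF.fittingCongruenceFrameAtErratumDataB_of_members_of_prop323` (two named facts; [SU14] Lemma 3.1.9 is the
tree's theorem `SkinnerUrban2014.lemma319_finite_XBig_holds`, defn-ty1 g4 p523055), and composes them with g9's cut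
`P2.imcDivIntCoreFrameAtErratumDataB_of_roadFF_fitting` (p495387) — exactly the composition `IMCDivAtErratumDataAllR_of`
of the skeleton `Cruxes/IMCDivAtErratumDataAllR/Lines/birth.lean`, with every stub replaced by its proof from named facts.

## What this file proves

**`imcDivAtErratumDataAllR_of_weak_facts`**: the crux
`Summit.BirchSwinnertonDyer.BirchSwinnertonDyer.Theses.ErratumRoadFive.IMCDivAtErratumDataAllR`
(= `∀ W p, P2.IMCDivIntCoreFrameAtErratumDataB W p`) from FIVE named facts (g10's certificate took six) —
* FOUR PUBLISHED: `prop332_charIdeal_XAc_sigma_change_of_noTamagawaDefect` ([JSW17] Prop. 3.3.2, corrected form),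
  `rank_eq_analyticRank_of_analyticRank_le_one` (Gross–Zagier–Kolyvagin), `exists_isNewformOf` (modularity),
  `SkinnerUrban2014.prop323_XAc_equiv_XBigDecomp` ([SU14] Prop. 3.2.3, Shapiro) — [SU14] Lemma 3.1.9 being now the
  tree's THEOREM `SkinnerUrban2014.lemma319_finite_XBig_holds`;
* ONE OPEN, claim-tagged, UNREFEREED: `Castella2018.erratum_members_exists_charIdeal_le_of_isTorsion_congruence_OPEN`
  (the erratum's member package WITHOUT Thm. 2.3's torsion clause: frame of `f` [Cas18 Thm. 3.1], Hida members (a)(b)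
  [Ski16 §2.6], (2.5)_m via [FW21, Thm. 4.41] under the torsion premise, (c) [Cas20 Thm. 2.11]);
and **`imcDivAtErratumDataAllR_of_publishedInputsIMCReduction_of_weak_facts`**, the same keyed to the route's HELD
bundle `PublishedInputsIMCReduction` (item 19283; GZK = conjunct 2, modularity = conjunct 4).
HONEST FRAMING: a certificate "crux ⟸ named facts", nothing more; CONDITIONAL on the five facts, one of them OPEN
(resting on the unrefereed erratum and arXiv:2107.13726 Thm. 4.41 — but NOT on erratum Thm. 2.3's torsion clause); the
crux is NOT proved; the anticyclotomic main conjecture is asserted nowhere; BSD is proved for no pair; no census number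
moves (T7); closes rung K2 of BirchSwinnertonDyer for NO pair. Theorems only (no definition, no named fact, no `sorry`).

References: [Castella2018Erratum] Thm. 1.1, Thm. 2.3, (2.4)–(2.5), proof of Thm. 1.1 (pp. 1–4); [FouquetWan2021]
Thm. 4.41 (PREPRINT); [JetchevSkinnerWan2017] Prop. 3.3.2; [SkinnerUrban2014] Prop. 3.2.3, Lemma 3.1.9;
[Skinner2016PacificMC] §2.3, §2.6, §3.1; [Castella2020JIMJ] Thm. 2.11; [Castella2018] Thm. 3.1, (3.1);
pub/bsd-cited/sheets/AUDIT-Castella2018-ErratumHidaMembers-T3-r17-ADDENDUM-7-f97a85fb.md §R-f.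
-/

set_option autoImplicit false

noncomputable section

open scoped Classical
open WeierstrassCurve NumberField IsDedekindDomain
open Literature.NumberTheory.EllipticCurves Literature.NumberTheory.EllipticCurves.ModularForms
  Literature.NumberTheory.EllipticCurves.Rank1Residual Literature.NumberTheory.EllipticCurves.JetchevSkinnerWan2017
  Literature.NumberTheory.EllipticCurves.Castella2018
open Summit.BirchSwinnertonDyer.Rank1Residual.X11b

namespace Summit.BirchSwinnertonDyer.BirchSwinnertonDyer.Theorems

/-- **THE CRUX `IMCDivAtErratumDataAllR` BY NAME, MODULO NAMED FACTS (Road FF), OPEN input in torsion-free premise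
form** — `Σ`-data from [JSW17] Prop. 3.3.2 (corrected form) + GZK + modularity (imc-p1 g9, p500562), the two-slot
Fitting congruence frame from the erratum's member package WITHOUT Thm. 2.3's torsion clause + [SU14] Prop. 3.2.3
(imc-p1 g11, `…_of_members_of_prop323`; [SU14] Lemma 3.1.9 discharged in-tree), composed by the Road-FF cut (p495387).
CONDITIONAL on the five named facts, ONE of them OPEN and unrefereed; nothing is booked.
[claim: Castella2018Erratum, status: under-review] [claim: FouquetWan2021, status: under-review]
[cite: Castella2018Erratum, (2.4)–(2.5) and proof of Thm. 1.1 (pp. 3–4)] [cite: JetchevSkinnerWan2017, Prop. 3.3.2]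
[cite: SkinnerUrban2014, Prop. 3.2.3 and Lemma 3.1.9 (p. 20)] -/
theorem imcDivAtErratumDataAllR_of_weak_facts
    (h332 : prop332_charIdeal_XAc_sigma_change_of_noTamagawaDefect)
    (hGZK : rank_eq_analyticRank_of_analyticRank_le_one) (hnf : exists_isNewformOf)
    (hSh : SkinnerUrban2014.prop323_XAc_equiv_XBigDecomp)
    (hMem : erratum_members_exists_charIdeal_le_of_isTorsion_congruence_OPEN) :
    Summit.BirchSwinnertonDyer.BirchSwinnertonDyer.Theses.ErratumRoadFive.IMCDivAtErratumDataAllR :=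
  fun W _ _ p _ ↦
    P2.imcDivIntCoreFrameAtErratumDataB_of_roadFF_fitting
      (P2.RoadFF.sigmaDataAtErratumDataB_of_prop332_of_noTamagawaDefect W p h332 hGZK hnf)
      (P2.RoadFF.fittingCongruenceFrameAtErratumDataB_of_members_of_prop323 hMem hSh W p)

/-- **The same certificate keyed to the route's HELD bundle `PublishedInputsIMCReduction`** (item 19283; binder `hF` of
K2's `closes`), which supplies GZK (conjunct 2) and modularity (conjunct 4): the crux `IMCDivAtErratumDataAllR` BY NAME
from `PublishedInputsIMCReduction` + [JSW17] Prop. 3.3.2 (corrected form) + [SU14] Prop. 3.2.3 + the erratum's member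
package in torsion-free premise form — the shape a route-level `have h3 := …` would use.
CONDITIONAL; nothing booked. [claim: Castella2018Erratum, status: under-review] [claim: FouquetWan2021, status: under-review]
[cite: Castella2018Erratum, (2.4)–(2.5) and proof of Thm. 1.1 (pp. 3–4)] -/
theorem imcDivAtErratumDataAllR_of_publishedInputsIMCReduction_of_weak_facts
    (hF : Summit.BirchSwinnertonDyer.BirchSwinnertonDyer.Theses.ErratumRoadFive.PublishedInputsIMCReduction)
    (h332 : prop332_charIdeal_XAc_sigma_change_of_noTamagawaDefect)
    (hSh : SkinnerUrban2014.prop323_XAc_equiv_XBigDecomp)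
    (hMem : erratum_members_exists_charIdeal_le_of_isTorsion_congruence_OPEN) :
    Summit.BirchSwinnertonDyer.BirchSwinnertonDyer.Theses.ErratumRoadFive.IMCDivAtErratumDataAllR :=
  imcDivAtErratumDataAllR_of_weak_facts h332 hF.2.1 hF.2.2.2.1 hSh hMem

end Summit.BirchSwinnertonDyer.BirchSwinnertonDyer.Theorems

end
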